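/-
Copyright (c) 2026 the pub-hodgecm-mathlib formalisation cell (harness21).  Prover seat hodgecm-mathlib-F0P3a-p08 (g25): LH4-plan (g6) WORD #92∕#98 — the Lean certificate of
(P3f) census FINDING (D) «Flicker's permutation trick survives in the trace frame» (design of the (P3c) representatives package, LH4-p01 (g6)); 2026-09-02.
-/
import Literature.NumberTheory.Rogawski1990.FlickerClassesTraceFrame      -- ★ p851771: the `(1,1,0)`∕`(0,1,1)` norm tests `normTest_conj110_iff`∕`normTest_conj011_iff` over `Q_b` (+ ★ p851724 (T2)(T3)(T5))
import HarnessLib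

/-!
# Flicker's permutation trick in the trace frame: integral conjugators `g₃, g₄` of `t₁^{(b)}` onto the `π`-literal with PERMUTED eigenvalues
# (Flicker 1998 §2 Prop. 3 pp. 78–79; Rogawski 1990 §3.5 Prop. 3.5.2 (a), §3.6; Jacobowitz 1962 §7)

Topic `NumberTheory/Rogawski1990`; namespace `Literature.NumberTheory.Rogawski1990`.  THEOREMS ONLY (no definition, no instance, no notation, no named fact, no `sorry`);
count-neutral; kernel lane `--supports stmt-HodgeConjecture-24833`.  Cell `pub/hodgecm-mathlib` (D-0151), crux H413 = `stmt-HodgeConjecture-24833`, half A line LH4 (dyadic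
pay-down; (D-UNR) PRINT by ruling D74′), LEAD T13-42 price list (4), LH4-plan (g6) WORDS #92∕#98 (CENSUS-M1 bf2b9cff8e6aee20 «literal layer»; (P3f) census
`F0/P3a/F0P3a-p08/g25/p3f/CENSUS-P3f-socket-gside.v1.F0P3ap08g25.md` §3 (D)).  HONEST READER LABEL: BANKED base layer for the (P3c) representatives package
(`exists_four_matched_trace_representatives`, LH4-p01 (g6)) and the LAYER B count heads (two literal shapes `t₁^{(b)}`, `t_π^{(b)}`, LH4-p03 (g8)); HC_CM is proved only modulo
the 7 printed citations (2 remaining named inputs: hLiu418 = stmt-HodgeConjecture-24832, h413 = stmt-HodgeConjecture-24833) until rung 0 closes; pure commutative algebra, pays no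
organ, opens no road.

THE POINT.  In ★ `exists_four_matched_flicker_representatives` the classes `t₃, t₄` are realised TWICE: as conjugates `g₃ t₁ g₃⁻¹`, `g₄ t₁ g₄⁻¹` (for the κ-signs) AND as the
`π`-literal with PERMUTED eigenvalues `t_π(a,d,u)`, `t_π(u,a,d)` (for the values ∕ counts: ★ `gThree_mul_flickerTorusElt_one : g₃·t₁(a,b,c) = t_π(a,c,b)·g₃`), so that the count
engine needs theorems for exactly TWO literal shapes.  The same holds over the trace frame `Q_b = (1 0 1; 0 1 0; b 0 −σb)` (`b + σb = 1`, ★ p851724) with EXPLICIT INTEGRAL conjugators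
  `g₄ := !![πb, π, −π; σb, 0, 1; −bσb, b, σb] = D_π·Q_b·S₁₂·Q_b⁻¹`,   `g₃ := !![πσb, π, π; εb, 0, −ε; bσb, −σb, b] = D_π·Q_b·S₂₃·D_ε·Q_b⁻¹`
(`D_π = diag(π,1,1)`, `S₁₂`∕`S₂₃` transpositions, `D_ε = diag(1,1,ε)` with `σε·ε = −1`): `g₄·t₁^{(b)}(a,m,c) = t_π^{(b)}(m,a,c)·g₄`, `g₃·t₁^{(b)}(a,m,c) = t_π^{(b)}(a,c,m)·g₃`
(`gFourTrace_mul_traceTorusElt`, `gThreeTrace_mul_traceTorusElt`), frames `g₄·Q_b = !![0,π,π; 1,0,0; 0,b,−σb]`, `g₃·Q_b = !![π,π,0; 0,0,ε; b,−σb,0]` (`g…_mul_traceFrame`) with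
`Φ₃`-Grams `diag(1,π,−π)`, `diag(π,−π,−1)` (`twistGram_traceFrameFour∕Three`) = the hypotheses `hG₄`, `hG₃` of ★ p851771's `conjClassesIn_traceTorusElt_eq` ∕
`finKappaAt_trace_representatives_eq` ON THE NOSE; determinants `−π`, `−πε` (units over the field); and the literal-form norm tests `normTest_gFourTrace_conj_iff` `(0,1,1)`,
`normTest_gThreeTrace_conj_iff` `(1,1,0)` — the twins of ★ `normTest_gFour∕gThree_conj_iff (h2e) (hy∕hx)` with NO `e = ½`, NO `x x̄ = 2`, NO `y ȳ = −2`: the norm-`(−1)` unit `ε`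
only RESCALES the middle eigenvector `e₂` of the `t₃`-frame.  (All four matrix identities and both Grams were first checked entrywise in a split model `R = ℚ × ℚ`, `σ` = swap.)

## References
* [Flicker1998UnitaryFL] Y. Z. Flicker, *Elementary proof of the fundamental lemma for a unitary group*, Canad. J. Math. 50 (1998), §2 Prop. 3 pp. 78–79 (`g₃, g₄`, `P₃, P₄`).
* [Rogawski1990] J. D. Rogawski, *Automorphic Representations of Unitary Groups in Three Variables* (1990), §3.5 Prop. 3.5.2 (a) p. 29, §3.6 p. 31 (sign vectors of frames).
* [Jacobowitz1962] R. Jacobowitz, *Hermitian forms over local fields*, Amer. J. Math. 84 (1962), §7 Thm. 7.1 (unramified dyadic: trace condition, units are norms).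
-/

set_option autoImplicit false

noncomputable section

open Matrix
open scoped MatrixGroups

namespace Literature.NumberTheory.Rogawski1990

open Literature.NumberTheory.Automorphic

/-! ## §1 Flicker's PERMUTATION TRICK in the trace frame: integral conjugators `g₃, g₄` with `g₃·t₁^{(b)}(a,m,c) = t_π^{(b)}(a,c,m)·g₃`,
`g₄·t₁^{(b)}(a,m,c) = t_π^{(b)}(m,a,c)·g₄`, whose frames `g₃·Q_b`, `g₄·Q_b` have Grams `diag(π,−π,−1)`, `diag(1,π,−π)` — so the classes `t₃, t₄` are again `π`-LITERALS with
PERMUTED eigenvalues (one literal shape for the count engine), exactly as Flicker's `g₃ t₁(a,b,c) g₃⁻¹ = t_π(a,c,b)`, `g₄ t₁ g₄⁻¹ = t_π(b,a,c)` (★ `gThree_mul_flickerTorusElt_one`) -/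

section Permutation

variable {R : Type*} [CommRing R] (σ : R →+* R)

/-- **`g₄ := !![πb, π, −π; σb, 0, 1; −bσb, b, σb] = diag(π,1,1)·Q_b·S₁₂·Q_b⁻¹`** (`S₁₂` the transposition of slots 1, 2; `Q_b⁻¹ = (σb 0 1; 0 1 0; b 0 −1)` ★ (T2)) — INTEGRAL, no `½`
(Flicker: `g₄ = !![eπ, π, eπ; e, 0, −e; e, −1, e]`).  Its frame: `g₄·Q_b = !![0, π, π; 1, 0, 0; 0, b, −σb]` (columns `e₂, (π,0,b), (π,0,−σb)`; Flicker's `P₄ = !![0, π, π; 1, 0, 0; 0, −1, 1]`).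
[cite: Flicker1998UnitaryFL, §2 Prop. 3 p. 79] -/
theorem gFourTrace_mul_traceFrame {b : R} (hb : b + σ b = 1) (π : R) :
    !![π * b, π, -π; σ b, 0, 1; -(b * σ b), b, σ b] * !![(1 : R), 0, 1; 0, 1, 0; b, 0, -σ b] = !![0, π, π; 1, 0, 0; 0, b, -σ b] := by
  have hb' : σ b + b = 1 := by rw [add_comm]; exact hb
  ext i j
  fin_cases i <;> fin_cases j <;> simp [Matrix.mul_apply, Fin.sum_univ_three] <;> grind

/-- **`g₃ := !![πσb, π, π; εb, 0, −ε; bσb, −σb, b] = diag(π,1,1)·Q_b·S₂₃·diag(1,1,ε)·Q_b⁻¹`** (`S₂₃` the transposition of slots 2, 3; `ε` any scalar — a unit of norm `−1` in the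
application) — INTEGRAL (Flicker: `g₃ = !![eπ, π, −eπ; e, 0, e; −e, 1, e]`).  Its frame: `g₃·Q_b = !![π, π, 0; 0, 0, ε; b, −σb, 0]` (columns `(π,0,b), (π,0,−σb), ε·e₂`; Flicker's
`P₃ = !![π, π, 0; 0, 0, 1; −1, 1, 0]`). [cite: Flicker1998UnitaryFL, §2 Prop. 3 p. 79] -/
theorem gThreeTrace_mul_traceFrame {b : R} (hb : b + σ b = 1) (π ε : R) :
    !![π * σ b, π, π; ε * b, 0, -ε; b * σ b, -σ b, b] * !![(1 : R), 0, 1; 0, 1, 0; b, 0, -σ b] = !![π, π, 0; 0, 0, ε; b, -σ b, 0] := by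
  have hb' : σ b + b = 1 := by rw [add_comm]; exact hb
  ext i j
  fin_cases i <;> fin_cases j <;> simp [Matrix.mul_apply, Fin.sum_univ_three] <;> grind

/-- **THE PERMUTATION TRICK, class `t₄`: `g₄·t₁^{(b)}(a,m,c) = t_π^{(b)}(m,a,c)·g₄`** (`b + σb = 1`, `ππ′ = 1`) — the `g₄`-conjugate of the trace literal is the `π`-literal ★ (T5) with
the first two eigenvalues SWAPPED (twin of ★ `gFour_mul_flickerTorusElt_one : g₄·t₁(a,b,c) = t_π(b,a,c)·g₄`, no `2e = 1`). [cite: Flicker1998UnitaryFL, §2 Prop. 3 pp. 78–79] -/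
theorem gFourTrace_mul_traceTorusElt {b : R} (hb : b + σ b = 1) {π π' : R} (hπ : π * π' = 1) (a m c : R) :
    !![π * b, π, -π; σ b, 0, 1; -(b * σ b), b, σ b] * !![a * σ b + c * b, 0, a - c; 0, m, 0; b * σ b * (a - c), 0, a * b + c * σ b] =
      !![m * σ b + c * b, 0, π * (m - c); 0, a, 0; π' * (b * σ b * (m - c)), 0, m * b + c * σ b] * !![π * b, π, -π; σ b, 0, 1; -(b * σ b), b, σ b] := by
  have hb' : σ b + b = 1 := by rw [add_comm]; exact hb
  ext i j
  fin_cases i <;> fin_cases j <;> simp [Matrix.mul_apply, Fin.sum_univ_three] <;> grind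

/-- **THE PERMUTATION TRICK, class `t₃`: `g₃·t₁^{(b)}(a,m,c) = t_π^{(b)}(a,c,m)·g₃`** (`b + σb = 1`, `ππ′ = 1`, any `ε`) — the `g₃`-conjugate is the `π`-literal with the last two
eigenvalues SWAPPED (twin of ★ `gThree_mul_flickerTorusElt_one : g₃·t₁(a,b,c) = t_π(a,c,b)·g₃`, no `2e = 1`). [cite: Flicker1998UnitaryFL, §2 Prop. 3 pp. 78–79] -/
theorem gThreeTrace_mul_traceTorusElt {b : R} (hb : b + σ b = 1) {π π' : R} (hπ : π * π' = 1) (ε a m c : R) :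
    !![π * σ b, π, π; ε * b, 0, -ε; b * σ b, -σ b, b] * !![a * σ b + c * b, 0, a - c; 0, m, 0; b * σ b * (a - c), 0, a * b + c * σ b] =
      !![a * σ b + m * b, 0, π * (a - m); 0, c, 0; π' * (b * σ b * (a - m)), 0, a * b + m * σ b] * !![π * σ b, π, π; ε * b, 0, -ε; b * σ b, -σ b, b] := by
  have hb' : σ b + b = 1 := by rw [add_comm]; exact hb
  ext i j
  fin_cases i <;> fin_cases j <;> simp [Matrix.mul_apply, Fin.sum_univ_three] <;> grind

/-- **Gram of the `t₄`-frame `g₄·Q_b = !![0, π, π; 1, 0, 0; 0, b, −σb]`: `diag(1, π, −π)`** (`σσ = id`, `b + σb = 1`, `σπ = π`) — lengths `1, π(b+σb), −π(b+σb)`: the `(0,1,1)` pattern,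
`ε`-FREE; this is `hG₄` of `conjClassesIn_traceTorusElt_eq` ∕ `finKappaAt_trace_representatives_eq` on the nose (twin of ★ `twistGram_frameFour`). [cite: Rogawski1990, §3.5 Prop. 3.5.2 (a) p. 29; §3.6 p. 31]
[cite: Flicker1998UnitaryFL, §2 Prop. 3 p. 79] -/
theorem twistGram_traceFrameFour (hσσ : ∀ x, σ (σ x) = x) {b : R} (hb : b + σ b = 1) {π : R} (hσπ : σ π = π) :
    twistGram σ (Matrix.of fun i j : Fin 3 => if i.val + j.val + 1 = 3 then (1 : R) else 0) !![0, π, π; 1, 0, 0; 0, b, -σ b] =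
      !![1, 0, 0; 0, π, 0; 0, 0, -π] := by
  have hb' : σ b + b = 1 := by rw [add_comm]; exact hb
  rw [twistGram_def]
  ext i j
  fin_cases i <;> fin_cases j <;>
    simp [Matrix.mul_apply, Fin.sum_univ_three, Matrix.of_apply, map_neg, hσσ, hσπ] <;> grind

/-- **Gram of the `t₃`-frame `g₃·Q_b = !![π, π, 0; 0, 0, ε; b, −σb, 0]`: `diag(π, −π, −1)`** (`σσ = id`, `b + σb = 1`, `σπ = π`, `σε·ε = −1`) — lengths `π, −π, σε·ε`: the `(1,1,0)`
pattern; this is `hG₃` on the nose (twin of ★ `twistGram_frameThree`; the norm-`(−1)` unit `ε` only RESCALES the middle eigenvector `e₂`, where Flicker needed `x x̄ = 2`).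
[cite: Rogawski1990, §3.5 Prop. 3.5.2 (a) p. 29; §3.6 p. 31] [cite: Flicker1998UnitaryFL, §2 Prop. 3 p. 79] [cite: Jacobowitz1962, §7 Thm. 7.1] -/
theorem twistGram_traceFrameThree (hσσ : ∀ x, σ (σ x) = x) {b : R} (hb : b + σ b = 1) {π ε : R} (hσπ : σ π = π) (hε : σ ε * ε = -1) :
    twistGram σ (Matrix.of fun i j : Fin 3 => if i.val + j.val + 1 = 3 then (1 : R) else 0) !![π, π, 0; 0, 0, ε; b, -σ b, 0] =
      !![π, 0, 0; 0, -π, 0; 0, 0, -1] := by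
  have hb' : σ b + b = 1 := by rw [add_comm]; exact hb
  rw [twistGram_def]
  ext i j
  fin_cases i <;> fin_cases j <;>
    simp [Matrix.mul_apply, Fin.sum_univ_three, Matrix.of_apply, map_neg, hσσ, hσπ, hε] <;> grind

/-- `det g₄ = −π·(b + σb)²` (`= −π`: a unit over the field, Flicker's `det g₄ = −π`). [cite: Flicker1998UnitaryFL, §2 Prop. 3 p. 79] -/
theorem det_gFourTrace (b π : R) : Matrix.det !![π * b, π, -π; σ b, 0, 1; -(b * σ b), b, σ b] = -(π * (b + σ b) ^ 2) := by
  simp [Matrix.det_fin_three]; ring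

/-- `det g₄ = −π` under `b + σb = 1`. [cite: Flicker1998UnitaryFL, §2 Prop. 3 p. 79] -/
theorem det_gFourTrace_eq_neg {b : R} (hb : b + σ b = 1) (π : R) : Matrix.det !![π * b, π, -π; σ b, 0, 1; -(b * σ b), b, σ b] = -π := by
  rw [det_gFourTrace, hb, one_pow, mul_one]

/-- `det g₃ = −πε·(b + σb)²` (`= −πε`; Flicker's `det g₃ = −π`). [cite: Flicker1998UnitaryFL, §2 Prop. 3 p. 79] -/
theorem det_gThreeTrace (b π ε : R) : Matrix.det !![π * σ b, π, π; ε * b, 0, -ε; b * σ b, -σ b, b] = -(π * ε * (b + σ b) ^ 2) := by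
  simp [Matrix.det_fin_three]; ring

/-- `det g₃ = −πε` under `b + σb = 1`. [cite: Flicker1998UnitaryFL, §2 Prop. 3 p. 79] -/
theorem det_gThreeTrace_eq_neg {b : R} (hb : b + σ b = 1) (π ε : R) : Matrix.det !![π * σ b, π, π; ε * b, 0, -ε; b * σ b, -σ b, b] = -(π * ε) := by
  rw [det_gThreeTrace, hb, one_pow, mul_one]

end Permutation

section PermutationTests

variable {K : Type*} [Field K] (σ : K →+* K)

/-- The tests of the conjugator `g₃ = !![πσb, π, π; εb, 0, −ε; bσb, −σb, b]` against `Q_b` read `(1,1,0)` — the literal twin of ★ `normTest_gThree_conj_iff (h2e) (hx) (hg₃)`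
(`hG₃` of `normTest_conj110_iff` discharged by `gThreeTrace_mul_traceFrame` + `twistGram_traceFrameThree`). [cite: Flicker1998UnitaryFL, §2 Prop. 3 p. 79]
[cite: Rogawski1990, §3.5 Prop. 3.5.2 (a) p. 29] [cite: Jacobowitz1962, §7 Thm. 7.1] -/
theorem normTest_gThreeTrace_conj_iff (hσσ : ∀ x, σ (σ x) = x) {b : K} (hb : b + σ b = 1) {π ε : K} (hσπ : σ π = π) (hπN : ∀ z : K, σ z * z ≠ π)
    (hε : σ ε * ε = -1) {Q g₃ : GL (Fin 3) K} (hQ : Q.val = !![(1 : K), 0, 1; 0, 1, 0; b, 0, -σ b])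
    (hg₃ : g₃.val = !![π * σ b, π, π; ε * b, 0, -ε; b * σ b, -σ b, b]) (i : Fin 3) :
    (∃ z : K, IsUnit z ∧
        twistGram σ (Matrix.of fun i j : Fin 3 => if i.val + j.val + 1 = 3 then (1 : K) else 0) (g₃.val * Q.val) i i =
          σ z * z * twistGram σ (Matrix.of fun i j : Fin 3 => if i.val + j.val + 1 = 3 then (1 : K) else 0) Q.val i i) ↔
      (![1, 1, 0] : Fin 3 → ZMod 2) i = 0 :=
  normTest_conj110_iff σ hσσ hb hπN hε hQ (by rw [hg₃, hQ, gThreeTrace_mul_traceFrame σ hb, twistGram_traceFrameThree σ hσσ hb hσπ hε]) i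

/-- The tests of the conjugator `g₄ = !![πb, π, −π; σb, 0, 1; −bσb, b, σb]` against `Q_b` read `(0,1,1)` — the literal twin of ★ `normTest_gFour_conj_iff (h2e) (hy) (hg₄)`, `ε`-free.
[cite: Flicker1998UnitaryFL, §2 Prop. 3 p. 79] [cite: Rogawski1990, §3.5 Prop. 3.5.2 (a) p. 29] -/
theorem normTest_gFourTrace_conj_iff (hσσ : ∀ x, σ (σ x) = x) {b : K} (hb : b + σ b = 1) {π : K} (hσπ : σ π = π) (hπN : ∀ z : K, σ z * z ≠ π)
    {Q g₄ : GL (Fin 3) K} (hQ : Q.val = !![(1 : K), 0, 1; 0, 1, 0; b, 0, -σ b])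
    (hg₄ : g₄.val = !![π * b, π, -π; σ b, 0, 1; -(b * σ b), b, σ b]) (i : Fin 3) :
    (∃ z : K, IsUnit z ∧
        twistGram σ (Matrix.of fun i j : Fin 3 => if i.val + j.val + 1 = 3 then (1 : K) else 0) (g₄.val * Q.val) i i =
          σ z * z * twistGram σ (Matrix.of fun i j : Fin 3 => if i.val + j.val + 1 = 3 then (1 : K) else 0) Q.val i i) ↔
      (![0, 1, 1] : Fin 3 → ZMod 2) i = 0 :=
  normTest_conj011_iff σ hσσ hb hπN hQ (by rw [hg₄, hQ, gFourTrace_mul_traceFrame σ hb, twistGram_traceFrameFour σ hσσ hb hσπ]) i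

end PermutationTests

end Literature.NumberTheory.Rogawski1990

end
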